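import Summits.QuantumFields.YangMills.Theorems.BalabanUVNodesPortZDPencilDerivative

/-!
# NODE O port, row PT-A′ helper lane (PTZ-1, gen 3): THE (Z) SIDE — [I] (2.12)'s «SUM OF TWO TERMS» for the ZERO-INPUT OUTPUT: `𝓝⁰_{k+1}(W)` is THE MEASURE TERM `𝐓_k(0)(W)`
# (the step of the ZERO action: the log-ratio of the gauge-fixed fibre volumes — print's «terms from log Z^{(k)}», [II] p. 21) PLUS THE LOG-MOMENT OF THE MAIN-TERM FLUCTUATION
# `A⁰_k − A⁰_k(Ū^k U_{k+1} W)` (print's expansion (2.6)–(2.8) of `−(1∕g_k²)A(U_k(B̃′U_{k+1}))` around the background, integrated: the `P^{(k)}`-moment) under the gauge-fixing fibre law —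
# generic over `Node00/ZeroInputStepT`; the split is this seat's history-channel identity read at the pair `(A, E) := (0, A⁰_k)`

[Balaban1987RG1] = [I] (CMP 109, 1987): (0.19) p. 255–256, (1.3)–(1.4) p. 260, (1.6) p. 261, (2.6)–(2.8) p. 266, (2.10)–(2.13) pp. 267–268 («The expression under the exponential is clearly a sum
of two terms, one is connected with the expansion of the action −(1∕g_k²)A(U_k(V)) and the measure in (2.1), and we denote it by P^{(k)}(g_k, U_{k+1}, B), another is the expression in the curly
bracket»); [Balaban1988RG2Cluster] = [II] (CMP 116, 1988): p. 21 («The effective action in (1.1.6) is obtained by adding to the above action the expression [log Z^{(k)}(U_{k+1}) − log Z^{(k)}(1)]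
… The expression localized in X satisfies the bound (1.1.18) … with an absolute constant instead of E₀. We define ½E₀ as equal to this constant»).

Seat `ymgap-nodeO-port-PTZ-1` g3 (prover, HELPER MODE; `--supports stmt-QuantumFields-27930 --as helper`).  Generic layer (0 tokens of the χ-cone of record); CRIT-1 Q-5 (β).  Every row is a
COROLLARY of this seat's `…PortZDHistoryFluctuation` (✓p805483), `…PortZDStepLaw` (✓p807160) and `…PortZDPencilDerivative` at the input pair `(A, E) := (0, A⁰_k)`: the zero action's step
is the reference, the main term is the «history».

WHAT IS PROVED (0 sorry; no `def` ∕ `instance` ∕ `notation`):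
* §1 `stepOutT_zero_eq_nextAction` — `R_k(0)(W) = 𝐓_k(0)(W) = log[T(χ_k e^{−GF_k∕g_k²})(W) ∕ T(χ_k e^{−GF_k∕g_k²})(1)]`: THE MEASURE TERM (the step of the zero action);
  `mainTermT_iter_Uk_one` — `A⁰_k(Ū^k U_{k+1}(1)) = 0` (`ε > 0`, `k + 1 ≤ m + K`; gen 0's `wilsonAction4_Uk_iter_Uk_one`); `zeroInputMergedTermT_eq_stepOutT_zero_add` — `𝓝⁰_{k+1} = R_k(0 + A⁰_k)`.
* §2 ★★ `zeroInputMergedTermT_eq_measureTerm_add_log_fluct` — for `T K k` degree-one homogeneous and the zero-action and zero-input steps defined at `W`, `1`: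
  `𝓝⁰_{k+1}(W) = 𝐓_k(0)(W) + log⟨e^{A⁰_k − A⁰_k(bg_W)}⟩^{GF}_W − log⟨e^{A⁰_k − A⁰_k(bg_1)}⟩^{GF}_1 − A⁰_k(bg_1)`, where `⟨e^{F}⟩^{GF}_V := T(χ_k e^{−GF_k∕g_k² + F})(V) ∕ T(χ_k e^{−GF_k∕g_k²})(V)` is the
  moment functional of the ZERO-ACTION (gauge-fixing) step; ★★ `…_of_unit` — with `A⁰_k(bg_1) = 0`: (2.12)'s «sum of two terms» EXACTLY.
* §3 ★★ `abs_zeroInput_sub_measureTerm_sub_firstOrder_le_var` — with the gauge-fixing fibre laws `μW`, `μ1` (displayed through `hμ` at `A := 0`):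
  `|𝓝⁰_{k+1}(W) − 𝐓_k(0)(W) − (⟨A⁰_k − A⁰_k(bg_W)⟩^{GF}_W − ⟨A⁰_k⟩^{GF}_1)| ≤ Var^{GF}_W(A⁰_k) + Var^{GF}_1(A⁰_k)` (centred brackets `≤ 1` a.e., exponential moments finite) — the
  `P^{(k)}`-moment is first order in the main-term fluctuation up to second cumulants; ★★ `hasDerivAt_zeroInput_pencil_zero` — the pencil `t ↦ R_k(t·A⁰_k)(W)` (ends: the measure term at
  `t = 0`, `𝓝⁰_{k+1}(W)` at `t = 1`) has slope `⟨A⁰_k − A⁰_k(bg_W)⟩^{GF}_W − ⟨A⁰_k⟩^{GF}_1` at `t = 0`.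
So the (Z) format `σ` of the signed 26648 text splits, at functional level, into the measure term's format (print's «absolute constant … ½E₀») and the `P^{(k)}`-moment's — nothing of either
format is claimed here.

HONEST FRAMING.  Corollaries (log algebra, the fibre-law interface, dominated differentiation — all from this seat's earlier files); the positivity of the step integrals, the fibre laws and the
a.e. bounds are HYPOTHESES displayed by name; NOTHING of Bałaban's estimates asserted, ported or discharged; no named fact introduced; 26648 ∕ 27930⁸ SIGNED·OPEN (content-gated), 27931 OPEN
(RC-3), 27932 CLOSED; K0⁷ ∕ K-Ax OPEN; counts unmoved; finite 𝕋⁴ at fixed ε — NOT continuum ∕ OS ∕ Clay; the Yang–Mills mass gap is NOT proved by any of this.  No `sorry`, no `instance`, no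
`notation`, no `def`.
-/

noncomputable section

open MeasureTheory

namespace Summit.QuantumFields.YangMills.Theorems.PortZD

open Literature.MathematicalPhysics.QuantumFieldTheory.Balaban1983to89
open Literature.MathematicalPhysics.QuantumFieldTheory.Balaban1983to89.Node00
open Literature.MathematicalPhysics.QuantumFieldTheory.Balaban1983to89.Node00.ZeroInput
open T4Continuum (T4Family)
open B12Eq019ActionBody (nextAction normConst integrand integrand_apply)

variable (F : T4Family) (N : ℕ) [NeZero N]

/-! ## §1. The measure term and the unit value of the main term -/

/-- **THE MEASURE TERM**: the step of the ZERO action, `R_k(0)(W) = 𝐓_k(0)(W) = log[𝐍_k(0)⁻¹ · T(χ_k e^{−GF_k∕g_k²})(W)]` — the log-ratio of the gauge-fixed fibre volumes over `W` and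
over `1` (print's «log Z^{(k)}(U_{k+1}) − log Z^{(k)}(1)» bookkeeping lives here). [cite: Balaban1987RG1, (0.19) p.255–256, (1.4) p.260, (2.12) p.268; Balaban1988RG2Cluster, p.21] -/
theorem stepOutT_zero_eq_nextAction (T : Transport F N) (χ : (K : ℕ) → (ℕ → ℝ) → (k : ℕ) → Density (F.P K) k (SU N)) (ε : ℝ) (K : ℕ) (g : ℕ → ℝ)
    (k : ℕ) (W : GaugeField (F.P K) (k + 1) (SU N)) :
    stepOutT F N T χ ε K g k 0 W = nextAction (T K k) (χ K g k) (gfOfRecord F N K k) (g k) 0 W := by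
  rw [stepOutT, Pi.zero_apply, sub_zero]

/-- **`A⁰_k(Ū^k U_{k+1}(1)) = 0`** (`ε > 0`, `k + 1 ≤ m + K`): gen 0's `wilsonAction4_Uk_iter_Uk_one`. [cite: Balaban1987RG1, (1.3) p.260, (0.21) p.256] -/
theorem mainTermT_iter_Uk_one {ε : ℝ} (hε : 0 < ε) {K : ℕ} (g : ℕ → ℝ) {k : ℕ} (hk : k + 1 ≤ (F.P K).m + (F.P K).K) :
    mainTermT F N ε K g k (Averaging.iter (avOfRecord F N K) k (Uk F N K (k + 1) ε 1)) = 0 := by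
  show -(1 / (g k) ^ 2) * wilsonAction4 (Uk F N K k ε (Averaging.iter (avOfRecord F N K) k (Uk F N K (k + 1) ε 1))) = 0
  rw [wilsonAction4_Uk_iter_Uk_one F N hε hk, mul_zero]

/-- `𝓝⁰_{k+1}(W) = R_k(0 + A⁰_k)(W)` (the zero action as reference input). [cite: Balaban1987RG1, (1.6) p.261 (bookkeeping)] -/
theorem zeroInputMergedTermT_eq_stepOutT_zero_add (T : Transport F N) (χ : (K : ℕ) → (ℕ → ℝ) → (k : ℕ) → Density (F.P K) k (SU N)) (ε : ℝ) (K : ℕ)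
    (g : ℕ → ℝ) (k : ℕ) (W : GaugeField (F.P K) (k + 1) (SU N)) :
    zeroInputMergedTermT F N T χ ε K g k W = stepOutT F N T χ ε K g k (0 + mainTermT F N ε K g k) W := by
  rw [zero_add, zeroInputMergedTermT_eq_stepOut]

/-! ## §2. (2.12)'s «sum of two terms»: measure term + the log-moment of the main-term fluctuation -/

/-- ★★ **`𝓝⁰_{k+1}(W) = 𝐓_k(0)(W) + log⟨e^{A⁰_k − A⁰_k(bg_W)}⟩^{GF}_W − log⟨e^{A⁰_k − A⁰_k(bg_1)}⟩^{GF}_1 − A⁰_k(bg_1)`** for `T K k` degree-one homogeneous, the zero-action step and the zero-input step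
defined at `W` and at `1` (`PortZD.stepOutT_add_sub_eq_log_fluct` at `(A, E) := (0, A⁰_k)`). [cite: Balaban1987RG1, (2.6)–(2.8) p.266, (2.12)–(2.13) p.268; Balaban1988RG2Cluster, p.21] -/
theorem zeroInputMergedTermT_eq_measureTerm_add_log_fluct (T : Transport F N) (χ : (K : ℕ) → (ℕ → ℝ) → (k : ℕ) → Density (F.P K) k (SU N)) (ε : ℝ) (K : ℕ)
    (g : ℕ → ℝ) (k : ℕ) (hT : ∀ (a : ℝ) (ρ : Density (F.P K) k (SU N)), T K k (fun U => a * ρ U) = fun V => a * T K k ρ V)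
    (W : GaugeField (F.P K) (k + 1) (SU N))
    (hZW : 0 < T K k (integrand (χ K g k) (gfOfRecord F N K k) (g k) 0) W)
    (hZ1 : 0 < T K k (integrand (χ K g k) (gfOfRecord F N K k) (g k) 0) 1)
    (h0W : 0 < T K k (integrand (χ K g k) (gfOfRecord F N K k) (g k) (mainTermT F N ε K g k)) W)
    (h01 : 0 < T K k (integrand (χ K g k) (gfOfRecord F N K k) (g k) (mainTermT F N ε K g k)) 1) :
    zeroInputMergedTermT F N T χ ε K g k W =
      nextAction (T K k) (χ K g k) (gfOfRecord F N K k) (g k) 0 W +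
      (Real.log (T K k (integrand (χ K g k) (gfOfRecord F N K k) (g k)
          (0 + fun U => mainTermT F N ε K g k U - mainTermT F N ε K g k (Averaging.iter (avOfRecord F N K) k (Uk F N K (k + 1) ε W)))) W /
        T K k (integrand (χ K g k) (gfOfRecord F N K k) (g k) 0) W) -
      Real.log (T K k (integrand (χ K g k) (gfOfRecord F N K k) (g k)
          (0 + fun U => mainTermT F N ε K g k U - mainTermT F N ε K g k (Averaging.iter (avOfRecord F N K) k (Uk F N K (k + 1) ε 1)))) 1 /
        T K k (integrand (χ K g k) (gfOfRecord F N K k) (g k) 0) 1) -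
      mainTermT F N ε K g k (Averaging.iter (avOfRecord F N K) k (Uk F N K (k + 1) ε 1))) := by
  have h := stepOutT_add_sub_eq_log_fluct F N T χ ε K g k hT 0 (mainTermT F N ε K g k) W hZW hZ1 (by rwa [zero_add]) (by rwa [zero_add])
  rw [← zeroInputMergedTermT_eq_stepOutT_zero_add, stepOutT_zero_eq_nextAction] at h
  linarith

/-- ★★ **(2.12)'s «SUM OF TWO TERMS» EXACTLY**: with `ε > 0`, `k + 1 ≤ m + K` the unit value `A⁰_k(bg_1)` vanishes and
`𝓝⁰_{k+1}(W) = 𝐓_k(0)(W) + log⟨e^{A⁰_k − A⁰_k(bg_W)}⟩^{GF}_W − log[𝐍_k(A⁰_k) ∕ 𝐍_k(0)]` — the MEASURE TERM plus the `P^{(k)}`-MOMENT (normalised at the unit by the ratio of the two (0.19)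
normalisation constants). [cite: Balaban1987RG1, (0.19) p.255–256, (2.6)–(2.8) p.266, (2.12)–(2.13) p.268; Balaban1988RG2Cluster, p.21] -/
theorem zeroInputMergedTermT_eq_measureTerm_add_log_fluct_of_unit (T : Transport F N) (χ : (K : ℕ) → (ℕ → ℝ) → (k : ℕ) → Density (F.P K) k (SU N))
    {ε : ℝ} (hε : 0 < ε) {K : ℕ} (g : ℕ → ℝ) {k : ℕ} (hk : k + 1 ≤ (F.P K).m + (F.P K).K)
    (hT : ∀ (a : ℝ) (ρ : Density (F.P K) k (SU N)), T K k (fun U => a * ρ U) = fun V => a * T K k ρ V) (W : GaugeField (F.P K) (k + 1) (SU N))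
    (hZW : 0 < T K k (integrand (χ K g k) (gfOfRecord F N K k) (g k) 0) W)
    (hZ1 : 0 < T K k (integrand (χ K g k) (gfOfRecord F N K k) (g k) 0) 1)
    (h0W : 0 < T K k (integrand (χ K g k) (gfOfRecord F N K k) (g k) (mainTermT F N ε K g k)) W)
    (h01 : 0 < T K k (integrand (χ K g k) (gfOfRecord F N K k) (g k) (mainTermT F N ε K g k)) 1) :
    zeroInputMergedTermT F N T χ ε K g k W =
      nextAction (T K k) (χ K g k) (gfOfRecord F N K k) (g k) 0 W +
      (Real.log (T K k (integrand (χ K g k) (gfOfRecord F N K k) (g k)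
          (0 + fun U => mainTermT F N ε K g k U - mainTermT F N ε K g k (Averaging.iter (avOfRecord F N K) k (Uk F N K (k + 1) ε W)))) W /
        T K k (integrand (χ K g k) (gfOfRecord F N K k) (g k) 0) W) -
      Real.log (normConst (T K k) (χ K g k) (gfOfRecord F N K k) (g k) (mainTermT F N ε K g k) /
        normConst (T K k) (χ K g k) (gfOfRecord F N K k) (g k) 0)) := by
  have h := zeroInputMergedTermT_eq_measureTerm_add_log_fluct F N T χ ε K g k hT W hZW hZ1 h0W h01
  have h0 := mainTermT_iter_Uk_one F N hε g hk
  have hfun : (0 + fun U => mainTermT F N ε K g k U - 0) = mainTermT F N ε K g k := by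
    funext U; rw [Pi.add_apply, Pi.zero_apply, zero_add, sub_zero]
  rw [h0, sub_zero, hfun] at h
  exact h

/-! ## §3. The `P^{(k)}`-moment is first order in the main-term fluctuation: cumulant booking and linear response -/

/-- ★★ **`|𝓝⁰_{k+1}(W) − 𝐓_k(0)(W) − (⟨A⁰_k − A⁰_k(bg_W)⟩^{GF}_W − ⟨A⁰_k⟩^{GF}_1)| ≤ Var^{GF}_W(A⁰_k) + Var^{GF}_1(A⁰_k)`** — with the gauge-fixing fibre laws `μW`, `μ1` of the ZERO-action step
(displayed through `hμW`, `hμ1`), the zero-action step defined at `W`, `1`, the centred main-term brackets `≤ 1` a.e. and their exponential moments finite (`ε > 0`, `k + 1 ≤ m + K`):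
`…PortZDStepLaw.abs_stepOutT_add_sub_sub_firstOrder_le_var` at `(0, A⁰_k)`. [cite: Balaban1987RG1, (2.6)–(2.8) p.266, (2.12)–(2.13) p.268; Balaban1988RG2Cluster, p.21] -/
theorem abs_zeroInput_sub_measureTerm_sub_firstOrder_le_var (T : Transport F N) (χ : (K : ℕ) → (ℕ → ℝ) → (k : ℕ) → Density (F.P K) k (SU N))
    {ε : ℝ} (hε : 0 < ε) {K : ℕ} (g : ℕ → ℝ) {k : ℕ} (hk : k + 1 ≤ (F.P K).m + (F.P K).K)
    (hT : ∀ (a : ℝ) (ρ : Density (F.P K) k (SU N)), T K k (fun U => a * ρ U) = fun V => a * T K k ρ V) (W : GaugeField (F.P K) (k + 1) (SU N))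
    {μW μ1 : Measure (GaugeField (F.P K) k (SU N))}
    (hμW : ∀ f : Density (F.P K) k (SU N),
      ∫ U, f U ∂μW = T K k (fun U => f U * integrand (χ K g k) (gfOfRecord F N K k) (g k) 0 U) W / T K k (integrand (χ K g k) (gfOfRecord F N K k) (g k) 0) W)
    (hμ1 : ∀ f : Density (F.P K) k (SU N),
      ∫ U, f U ∂μ1 = T K k (fun U => f U * integrand (χ K g k) (gfOfRecord F N K k) (g k) 0 U) 1 / T K k (integrand (χ K g k) (gfOfRecord F N K k) (g k) 0) 1)
    (hZW : 0 < T K k (integrand (χ K g k) (gfOfRecord F N K k) (g k) 0) W)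
    (hZ1 : 0 < T K k (integrand (χ K g k) (gfOfRecord F N K k) (g k) 0) 1)
    (hmW : AEStronglyMeasurable (fun U => mainTermT F N ε K g k U - mainTermT F N ε K g k (Averaging.iter (avOfRecord F N K) k (Uk F N K (k + 1) ε W))) μW)
    (hm1 : AEStronglyMeasurable (mainTermT F N ε K g k) μ1)
    (heW : Integrable (fun U => Real.exp (mainTermT F N ε K g k U - mainTermT F N ε K g k (Averaging.iter (avOfRecord F N K) k (Uk F N K (k + 1) ε W)))) μW)
    (he1 : Integrable (fun U => Real.exp (mainTermT F N ε K g k U)) μ1)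
    (hbW : ∀ᵐ U ∂μW, |mainTermT F N ε K g k U - mainTermT F N ε K g k (Averaging.iter (avOfRecord F N K) k (Uk F N K (k + 1) ε W)) -
      ∫ U', (mainTermT F N ε K g k U' - mainTermT F N ε K g k (Averaging.iter (avOfRecord F N K) k (Uk F N K (k + 1) ε W))) ∂μW| ≤ 1)
    (hb1 : ∀ᵐ U ∂μ1, |mainTermT F N ε K g k U - ∫ U', mainTermT F N ε K g k U' ∂μ1| ≤ 1) :
    |zeroInputMergedTermT F N T χ ε K g k W - nextAction (T K k) (χ K g k) (gfOfRecord F N K k) (g k) 0 W -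
        ((∫ U, (mainTermT F N ε K g k U - mainTermT F N ε K g k (Averaging.iter (avOfRecord F N K) k (Uk F N K (k + 1) ε W))) ∂μW) -
          ∫ U, mainTermT F N ε K g k U ∂μ1)| ≤
      (∫ U, (mainTermT F N ε K g k U - mainTermT F N ε K g k (Averaging.iter (avOfRecord F N K) k (Uk F N K (k + 1) ε W)) -
          ∫ U', (mainTermT F N ε K g k U' - mainTermT F N ε K g k (Averaging.iter (avOfRecord F N K) k (Uk F N K (k + 1) ε W))) ∂μW) ^ 2 ∂μW) +
      ∫ U, (mainTermT F N ε K g k U - ∫ U', mainTermT F N ε K g k U' ∂μ1) ^ 2 ∂μ1 := by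
  have h0 := mainTermT_iter_Uk_one F N hε g hk
  have h := abs_stepOutT_add_sub_sub_firstOrder_le_var F N T χ ε K g k hT 0 (mainTermT F N ε K g k) W hμW hμ1 hZW hZ1
    hmW (by simpa only [h0, sub_zero] using hm1) heW (by simpa only [h0, sub_zero] using he1) hbW (by simpa only [h0, sub_zero] using hb1)
  rw [← zeroInputMergedTermT_eq_stepOutT_zero_add, stepOutT_zero_eq_nextAction, h0, add_zero] at h
  simpa only [h0, sub_zero] using h

/-- ★★ **THE LINEAR RESPONSE OF THE ZERO-INPUT OUTPUT TO THE MAIN TERM**: the pencil `t ↦ R_k(t·A⁰_k)(W)` (the measure term at `t = 0`, `𝓝⁰_{k+1}(W)` at `t = 1`) has slope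
`⟨A⁰_k − A⁰_k(bg_W)⟩^{GF}_W − ⟨A⁰_k⟩^{GF}_1` at `t = 0` (gauge-fixing fibre laws displayed; brackets a.e.-bounded; `ε > 0`, `k + 1 ≤ m + K`) —
`…PortZDPencilDerivative.hasDerivAt_stepOutT_pencil_zero` at `(0, A⁰_k)`. [cite: Balaban1987RG1, (2.6)–(2.8) p.266, (2.12)–(2.14) p.268; Balaban1988RG2Cluster, (1.9) p.4] -/
theorem hasDerivAt_zeroInput_pencil_zero (T : Transport F N) (χ : (K : ℕ) → (ℕ → ℝ) → (k : ℕ) → Density (F.P K) k (SU N))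
    {ε : ℝ} (hε : 0 < ε) {K : ℕ} (g : ℕ → ℝ) {k : ℕ} (hk : k + 1 ≤ (F.P K).m + (F.P K).K)
    (hT : ∀ (a : ℝ) (ρ : Density (F.P K) k (SU N)), T K k (fun U => a * ρ U) = fun V => a * T K k ρ V) (W : GaugeField (F.P K) (k + 1) (SU N))
    {μW μ1 : Measure (GaugeField (F.P K) k (SU N))}
    (hμW : ∀ f : Density (F.P K) k (SU N),
      ∫ U, f U ∂μW = T K k (fun U => f U * integrand (χ K g k) (gfOfRecord F N K k) (g k) 0 U) W / T K k (integrand (χ K g k) (gfOfRecord F N K k) (g k) 0) W)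
    (hμ1 : ∀ f : Density (F.P K) k (SU N),
      ∫ U, f U ∂μ1 = T K k (fun U => f U * integrand (χ K g k) (gfOfRecord F N K k) (g k) 0 U) 1 / T K k (integrand (χ K g k) (gfOfRecord F N K k) (g k) 0) 1)
    (hZW : 0 < T K k (integrand (χ K g k) (gfOfRecord F N K k) (g k) 0) W)
    (hZ1 : 0 < T K k (integrand (χ K g k) (gfOfRecord F N K k) (g k) 0) 1) {MW M1 : ℝ}
    (hmW : AEStronglyMeasurable (fun U => mainTermT F N ε K g k U - mainTermT F N ε K g k (Averaging.iter (avOfRecord F N K) k (Uk F N K (k + 1) ε W))) μW)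
    (hm1 : AEStronglyMeasurable (mainTermT F N ε K g k) μ1)
    (hbW : ∀ᵐ U ∂μW, |mainTermT F N ε K g k U - mainTermT F N ε K g k (Averaging.iter (avOfRecord F N K) k (Uk F N K (k + 1) ε W))| ≤ MW)
    (hb1 : ∀ᵐ U ∂μ1, |mainTermT F N ε K g k U| ≤ M1) :
    HasDerivAt (fun t : ℝ => stepOutT F N T χ ε K g k (t • mainTermT F N ε K g k) W)
      ((∫ U, (mainTermT F N ε K g k U - mainTermT F N ε K g k (Averaging.iter (avOfRecord F N K) k (Uk F N K (k + 1) ε W))) ∂μW) -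
        ∫ U, mainTermT F N ε K g k U ∂μ1) 0 := by
  have h0 := mainTermT_iter_Uk_one F N hε g hk
  have h := hasDerivAt_stepOutT_pencil_zero F N T χ ε K g k hT 0 (mainTermT F N ε K g k) W hμW hμ1 hZW hZ1 hmW
    (by simpa only [h0, sub_zero] using hm1) hbW (by simpa only [h0, sub_zero] using hb1)
  simpa only [h0, sub_zero, zero_add] using h

end Summit.QuantumFields.YangMills.Theorems.PortZD

end
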